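import Summits.AtomisticToContinuum.BoseEinsteinCondensation.Theses.BECHardSphereReduction
import Summits.AtomisticToContinuum.BoseEinsteinCondensation.Theorems.BECHardSphereReductionHardCoreDominatesContinuityAtHardCore
import Summits.AtomisticToContinuum.BoseEinsteinCondensation.Theorems.BECHardSphereReductionHardCoreDominatesDiniReduction
import HarnessLib

/-!
# BECHardSphereReduction / HardCoreDominates — the crux inequality at a SINGLE `(v, R, N, L)` from the Dini sign there
# (line `birth`, skeleton v10; window-free pointwise form of the line's composition)

Crux `HardCoreDominates` (stmt-AtomisticToContinuum-11884) of route `BECHardSphereReduction`, line `birth`: the coupling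
path `v_t := v + t·1_{Iic R}` (`t : ℝ≥0`) from a measurable radial profile `v` vanishing beyond `R > 0` to the hard
spheres `HS_R := ⊤·1_{Iic R}` (the `t = ∞` endpoint). The skeleton of record (`Cruxes/HardCoreDominates/Lines/birth.lean`)
composes its one open stub `stub_diniSign` (the covariance sign in Dini form, inside a dilute window) with landed pieces.
This file records that composition sorry-free and POINTWISE — at one `(v, R, N, L)` at a time, with no window and no
guard — so that the crux's window is literally the window in which the sign is available:

* `condensateNumber_hardSphere_le_of_frequently` — if `cn(v_t) ≤ cn(v)` for arbitrarily large couplings `t`, then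
  `cn(HS_R) ≤ cn(v)` at that `(N, L)`: the landed lower semicontinuity at the hard core
  (`condensateNumber_hardSphere_le_liminf`, p151033) and `liminf ≤` a frequent bound;
* `condensateNumber_hardSphere_le_of_pathDominated` — in particular if every point of the path is dominated by its start;
* `stub_condensateNumber_hardSphere_le_of_dini` (registered stub of the line, by name) — in particular if the upper-right Dini derivative of `t ↦ cn(v_t)` is `≤ 0`
  at every coupling (`ε–h₀` form), by the landed local-to-global reduction `pathDominated_of_dini` (p155546, from
  `stub_pathLsc` p154150 and `stub_diniGlue` p154590);
* `hardCoreDominates_of_diniSign` / `hardCoreDominates_of_pathDominated` / `hardCoreDominates_of_frequentlyDominated` —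
  the crux BY NAME from each hypothesis quantified exactly as the registered stub `stub_diniSign` (resp. its integrated
  and its `liminf` residues), window for window.

No physics enters; the sign is an explicit hypothesis. What is deliberately NOT here: any claim about the sign itself
(that is `stub_diniSign`, open: the static response of the condensate occupation to the core overlap, uniformly in `N`).
-/

noncomputable section

namespace Summit.AtomisticToContinuum.BoseEinsteinCondensation.Cruxes.HardCoreDominates.Birth

open Literature.MathematicalPhysics.QuantumManyBody.BoseGas
open scoped ENNReal NNReal

/-- **The crux inequality at one `(N, L)` from frequent domination along the coupling path.** If
`condensateNumber (v + t·1_{Iic R}) N L ≤ condensateNumber v N L` for arbitrarily large `t`, then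
`condensateNumber HS_R N L ≤ condensateNumber v N L` — lower semicontinuity at the hard core (p151033) and
`liminf ≤` a frequent upper bound. No window, no guard. [folklore] -/
theorem condensateNumber_hardSphere_le_of_frequently (v : ℝ → ℝ≥0∞) (R : ℝ) (hmeas : Measurable v)
    (hR : 0 < R) (hvR : ∀ r : ℝ, R < r → v r = 0) (N : ℕ) (L : ℝ)
    (h : ∃ᶠ t : ℝ≥0 in Filter.atTop,
      condensateNumber (v + Set.indicator (Set.Iic R) (fun _ : ℝ => (t : ℝ≥0∞))) N L ≤ condensateNumber v N L) :
    condensateNumber (Set.indicator (Set.Iic R) (fun _ : ℝ => (⊤ : ℝ≥0∞))) N L ≤ condensateNumber v N L :=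
  (condensateNumber_hardSphere_le_liminf v R hmeas hR hvR N L).trans (Filter.liminf_le_of_frequently_le' h)

/-- **The crux inequality at one `(N, L)` from a path dominated by its start.** If
`condensateNumber (v + t·1_{Iic R}) N L ≤ condensateNumber v N L` for every finite coupling `t`, then
`condensateNumber HS_R N L ≤ condensateNumber v N L`. [folklore] -/
theorem condensateNumber_hardSphere_le_of_pathDominated (v : ℝ → ℝ≥0∞) (R : ℝ) (hmeas : Measurable v)
    (hR : 0 < R) (hvR : ∀ r : ℝ, R < r → v r = 0) (N : ℕ) (L : ℝ)
    (h : ∀ t : ℝ≥0,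
      condensateNumber (v + Set.indicator (Set.Iic R) (fun _ : ℝ => (t : ℝ≥0∞))) N L ≤ condensateNumber v N L) :
    condensateNumber (Set.indicator (Set.Iic R) (fun _ : ℝ => (⊤ : ℝ≥0∞))) N L ≤ condensateNumber v N L :=
  condensateNumber_hardSphere_le_of_frequently v R hmeas hR hvR N L (Filter.Eventually.of_forall h).frequently

/-- **The crux inequality at one `(N, L)` from the Dini sign there.** If at `(v, R, N, L)` the upper-right Dini
derivative of `t ↦ condensateNumber (v + t·1_{Iic R}) N L` is `≤ 0` at every coupling
(`∀ t, ∀ ε > 0, ∃ h₀ > 0, ∀ 0 < h ≤ h₀, cn(t + h) ≤ cn(t) + ε h`), then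
`condensateNumber HS_R N L ≤ condensateNumber v N L`: the landed local-to-global reduction along the path
(`pathDominated_of_dini`, p155546) and the landed lower semicontinuity at the hard core (p151033). This is the whole
composition of line `birth` at a single `(N, L)`; the crux's dilute window is then exactly the window in which the
sign holds. [folklore] -/
theorem stub_condensateNumber_hardSphere_le_of_dini :
    ∀ (v : ℝ → ENNReal) (R : ℝ), Measurable v → 0 < R → (∀ r : ℝ, R < r → v r = 0) → ∀ (N : ℕ) (L : ℝ),
      (∀ (t : NNReal) (ε : NNReal), 0 < ε → ∃ h₀ : NNReal, 0 < h₀ ∧ ∀ h : NNReal, 0 < h → h ≤ h₀ →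
        Literature.MathematicalPhysics.QuantumManyBody.BoseGas.condensateNumber
            (v + Set.indicator (Set.Iic R) (fun _ : ℝ => (((t + h : NNReal)) : ENNReal))) N L ≤
          Literature.MathematicalPhysics.QuantumManyBody.BoseGas.condensateNumber
            (v + Set.indicator (Set.Iic R) (fun _ : ℝ => (t : ENNReal))) N L + ((ε * h : NNReal) : ENNReal)) →
      Literature.MathematicalPhysics.QuantumManyBody.BoseGas.condensateNumber
          (Set.indicator (Set.Iic R) (fun _ : ℝ => (⊤ : ENNReal))) N L ≤
        Literature.MathematicalPhysics.QuantumManyBody.BoseGas.condensateNumber v N L :=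
  fun v R hmeas hR hvR N L hdini =>
    condensateNumber_hardSphere_le_of_pathDominated v R hmeas hR hvR N L (pathDominated_of_dini v R N L hdini)

/-- **`HardCoreDominates` from the Dini-form covariance sign (the registered stub `stub_diniSign`, quantified
verbatim).** For every measurable radial `v` vanishing beyond `R > 0`, a dilute window in which the upper-right Dini
derivative of `t ↦ condensateNumber (v + t·1_{Iic R}) N L` is `≤ 0` at every coupling gives the same window for
`condensateNumber HS_R N L ≤ condensateNumber v N L`. The hypothesis is the open sign content of the crux (static
response of the condensate occupation to the core overlap, uniform in `N`); nothing else is assumed. [folklore] -/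
theorem hardCoreDominates_of_diniSign
    (hD : ∀ (v : ℝ → ENNReal) (R : ℝ), Measurable v → 0 < R → (∀ r : ℝ, R < r → v r = 0) →
      ∃ η₀ : ℝ, 0 < η₀ ∧ ∀ (N : ℕ) (L : ℝ), (N : ℝ) * R ^ 3 ≤ η₀ * L ^ 3 →
        ∀ (t : NNReal) (ε : NNReal), 0 < ε → ∃ h₀ : NNReal, 0 < h₀ ∧ ∀ h : NNReal, 0 < h → h ≤ h₀ →
          Literature.MathematicalPhysics.QuantumManyBody.BoseGas.condensateNumber
              (v + Set.indicator (Set.Iic R) (fun _ : ℝ => (((t + h : NNReal)) : ENNReal))) N L ≤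
            Literature.MathematicalPhysics.QuantumManyBody.BoseGas.condensateNumber
              (v + Set.indicator (Set.Iic R) (fun _ : ℝ => (t : ENNReal))) N L + ((ε * h : NNReal) : ENNReal)) :
    Summit.AtomisticToContinuum.BoseEinsteinCondensation.Theses.BECHardSphereReduction.HardCoreDominates := by
  intro v R hmeas hR hvR
  obtain ⟨η₀, hη₀, h⟩ := hD v R hmeas hR hvR
  exact ⟨η₀, hη₀, fun N L hNL => stub_condensateNumber_hardSphere_le_of_dini v R hmeas hR hvR N L (h N L hNL)⟩

/-- **`HardCoreDominates` from finite-coupling domination** (the integrated residue of the line: adding the bounded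
repulsive bump `t·1_{Iic R}`, any `t < ∞`, does not raise the ground-state condensate number, in a `t`-uniform dilute
window). [folklore] -/
theorem hardCoreDominates_of_pathDominated
    (hP : ∀ (v : ℝ → ENNReal) (R : ℝ), Measurable v → 0 < R → (∀ r : ℝ, R < r → v r = 0) →
      ∃ η₀ : ℝ, 0 < η₀ ∧ ∀ (N : ℕ) (L : ℝ), (N : ℝ) * R ^ 3 ≤ η₀ * L ^ 3 → ∀ t : NNReal,
        Literature.MathematicalPhysics.QuantumManyBody.BoseGas.condensateNumber
            (v + Set.indicator (Set.Iic R) (fun _ : ℝ => (t : ENNReal))) N L ≤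
          Literature.MathematicalPhysics.QuantumManyBody.BoseGas.condensateNumber v N L) :
    Summit.AtomisticToContinuum.BoseEinsteinCondensation.Theses.BECHardSphereReduction.HardCoreDominates := by
  intro v R hmeas hR hvR
  obtain ⟨η₀, hη₀, h⟩ := hP v R hmeas hR hvR
  exact ⟨η₀, hη₀, fun N L hNL =>
    condensateNumber_hardSphere_le_of_pathDominated v R hmeas hR hvR N L (h N L hNL)⟩

/-- **`HardCoreDominates` from frequent domination** (the `liminf` floor of the line: `cn(v_t) ≤ cn(v)` for
arbitrarily large couplings `t`, in a dilute window). Given upper semicontinuity at the hard core this hypothesis is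
equivalent to the crux itself. [folklore] -/
theorem hardCoreDominates_of_frequentlyDominated
    (hF : ∀ (v : ℝ → ENNReal) (R : ℝ), Measurable v → 0 < R → (∀ r : ℝ, R < r → v r = 0) →
      ∃ η₀ : ℝ, 0 < η₀ ∧ ∀ (N : ℕ) (L : ℝ), (N : ℝ) * R ^ 3 ≤ η₀ * L ^ 3 → ∃ᶠ t : NNReal in Filter.atTop,
        Literature.MathematicalPhysics.QuantumManyBody.BoseGas.condensateNumber
            (v + Set.indicator (Set.Iic R) (fun _ : ℝ => (t : ENNReal))) N L ≤
          Literature.MathematicalPhysics.QuantumManyBody.BoseGas.condensateNumber v N L) :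
    Summit.AtomisticToContinuum.BoseEinsteinCondensation.Theses.BECHardSphereReduction.HardCoreDominates := by
  intro v R hmeas hR hvR
  obtain ⟨η₀, hη₀, h⟩ := hF v R hmeas hR hvR
  exact ⟨η₀, hη₀, fun N L hNL =>
    condensateNumber_hardSphere_le_of_frequently v R hmeas hR hvR N L (h N L hNL)⟩

end Summit.AtomisticToContinuum.BoseEinsteinCondensation.Cruxes.HardCoreDominates.Birth

end
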